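/-
Copyright: the b2b-balaban T⁴-continuum CRUX team, row NE7b OWNER lineage `t4-ne7b-p1` (gen 144). Project licence.
-/
import Summits.QuantumFields.BalabanUV.T4Continuum.Spine.NE7b.SupSupportCountedQuadrupleSums

/-!
# SUPPORT-COUNTED QUADRUPLE SUMS WITH A DISPLAY INDEX FIXED AND THE VERTEX SUMMED (toolbox II for the display-index slot letters of the
# order-5 entry majorant; the analogue of (574) for the other index roles).  (574) bounds the `x`-fixed sums of the supported star terms
# `𝟙·C∕(ρ_{x·}ρ_{x·})` and supported tree terms of (610)'s majorant.  For the letters `k5r⁺, k5s2⁺, k5s3⁺, k5s4⁺` a DISPLAY index is fixed and the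
# vertex `x` is summed; by the symmetry of `ρ` the leg sums `Σ_x ρ_{x q}⁻¹ ≤ S` remain uniform, and the supports are counted in their other index
# roles.  This file gives the generic finite-sum lemmas, each for an abstract `T` of the four summed indices with a vanishing hypothesis, a
# decay hypothesis and support counts: §1 helpers; §2 stars with a `K3`-pair (on the vertex or on a leg) — leg fixed, pair member fixed; §3
# stars with two single riders — vertex rider fixed, free leg fixed, a counted support against a leg function (covers the remaining roles);
# §4 supported trees against an abstract weight `W` with a summed bound `B` (rider fixed, leaf fixed with vertex riders, leaf fixed with a leaf
# rider, rider on a leaf) (row NE7b, node U5c; (574) `filter_sum_eq`, `card_mul_le`, (460) `tree_double_sum_le` BY NAME; [folklore] finite sums)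

Cell `pub-balaban`, sub-cell `t4`, spine estimate NE7b (`T4WeightBudget.RelWeightBound`; the cell's OWN estimate — NOT PRINTED in
[Bałaban 1983–89], NOT PROVED).  Crux-route work under `Spine/NE7b/` by the row OWNER (`t4-ne7b-p1` gen 144, file (614)) under FREEZE
(0)'s crux-prover clause; NOTHING of Bałaban's is named as a Lean object, valued or asserted; no `T4Continuum/Support` leaf typed; no
`def`, no notation; zero `sorry`.  Imports (BY NAME): the OWNER's (574) `…SupSupportCountedQuadrupleSums` ((460) through it).

WHAT IS PROVED ([folklore]): §1 `leg_sum_symm`, `leg_tri_sum_le`; §2 `pair_vertex_leg_fixed`, `pair_vertex_member_fixed`, `pair_counted_leg_fn`,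
`pair_leg_otherleg_fixed`; §3 `vertex_rider_fixed`, `two_riders_leg_fixed`, `counted_then_riders_leg_fn`, `leg_rider_leg_fn`; §4 `tree_rider_fixed`,
`tree_leaf_fixed_vertex_riders`, `tree_leaf_fixed_leaf_rider`, `tree_rider_on_leaf`; §5 toy.

HONEST (what this is NOT).  Finite sums; the four slot files (instantiating these with (610)'s terms) are the next files (memo SCOPING-d16 §A).
Scalar skeleton ((A3), NC-NE7b-α UNRULED); nothing of Bałaban's asserted.  BY-NAME EFFECT ON THE WALL: NONE.  NE7b NOT PRINTED ∕ NOT PROVED;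
spine PROVED 0∕9; rung (B)+1 — the programme's measures remain FINITE-torus statements; NOT the mass gap, NOT Clay.  HONEST DEPENDENCY:
continuum YM on T⁴ ⇐ BetaPertH ∧ nine spine estimates (0∕9 proved); BetaPertH ⇐ (D1) ∧ (D4) ∧ CAP+tail; G-an2-4 gates asym, D1 and NE2∕3∕4.
-/

set_option autoImplicit false

noncomputable section

namespace Summit.QuantumFields.BalabanUV.T4Continuum.NE7b.SupFifthKernelSlotSupportSums

open Finset
open scoped BigOperators
open SupSupportCountedQuadrupleSums (filter_sum_eq card_mul_le)
open SupThirdCumulantTreeDecay (tree_double_sum_le)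

variable {ι : Type} [Fintype ι]

variable {ρ : ι → ι → ℝ} {C S N N₁ N₂ B : ℝ}

/-! ## §1. Helpers: leg sums by symmetry; a leg through a pair of legs -/

/-- `Σ_x ρ_{xu}⁻¹ ≤ S` from the row letter and symmetry. [folklore] -/
theorem leg_sum_symm (hρsymm : ∀ x y, ρ x y = ρ y x) (hS : ∀ u, ∑ v, 1 / ρ u v ≤ S) (u : ι) : ∑ x, 1 / ρ x u ≤ S := by
  have h := hS u
  simp_rw [hρsymm u] at h
  exact h

/-- `Σ_d C∕(ρ_{xp}ρ_{xd}) ≤ C∕ρ_{xp}·S`. [folklore] -/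
theorem leg_tri_sum_le (hC : 0 ≤ C) (hρ1 : ∀ x y, 1 ≤ ρ x y) (hS : ∀ u, ∑ v, 1 / ρ u v ≤ S) (x p : ι) :
    ∑ d, C / (ρ x p * ρ x d) ≤ C / ρ x p * S := by
  have hCp : 0 ≤ C / ρ x p := div_nonneg hC (zero_le_one.trans (hρ1 x p))
  calc ∑ d, C / (ρ x p * ρ x d) = ∑ d, C / ρ x p * (1 / ρ x d) := Finset.sum_congr rfl fun d _ => by rw [div_mul_div_comm, mul_one]
    _ = C / ρ x p * ∑ d, 1 / ρ x d := (Finset.mul_sum _ _ _).symm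
    _ ≤ C / ρ x p * S := mul_le_mul_of_nonneg_left (hS x) hCp

/-- `Σ_x C∕ρ_{xq}·S ≤ C·S²` (the leg `q` summed over the vertex by symmetry). [folklore] -/
theorem vertex_leg_sum_le (hC : 0 ≤ C) (hρsymm : ∀ x y, ρ x y = ρ y x) (hS : ∀ u, ∑ v, 1 / ρ u v ≤ S) (hS0 : 0 ≤ S) (q : ι) :
    ∑ x, C / ρ x q * S ≤ C * S ^ 2 := by
  calc ∑ x, C / ρ x q * S = C * S * ∑ x, 1 / ρ x q := by
        rw [Finset.mul_sum]; exact Finset.sum_congr rfl fun x _ => by ring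
    _ ≤ C * S * S := mul_le_mul_of_nonneg_left (leg_sum_symm hρsymm hS q) (mul_nonneg hC hS0)
    _ = C * S ^ 2 := by ring

/-! ## §2. Stars carrying a `K3`-pair -/

/-- **PAIR ON THE VERTEX, A LEG FIXED** (`𝟙[K a b x]·C∕(ρ_{xq}ρ_{xd})`, `q` fixed; summed over `x, a, b, d`): for every vertex `x` the pairs
`(a,b)` with `K a b x ≠ 0` number `≤ N`; `Σ_{x,a,b,d}|T| ≤ N·C·S²`. [folklore] -/
theorem pair_vertex_leg_fixed [Nonempty ι] (T : ι → ι → ι → ι → ℝ) (K : ι → ι → ι → ℝ) (q : ι) (hC : 0 ≤ C) (hρ1 : ∀ x y, 1 ≤ ρ x y)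
    (hρsymm : ∀ x y, ρ x y = ρ y x) (hS : ∀ u, ∑ v, 1 / ρ u v ≤ S) (h0 : ∀ x a b, K a b x = 0 → ∀ d, T x a b d = 0)
    (hT : ∀ x a b d, |T x a b d| ≤ C / (ρ x q * ρ x d)) (hn : ∀ x, ∑ a, ((Finset.univ.filter (fun b => K a b x ≠ 0)).card : ℝ) ≤ N) :
    ∑ x, ∑ a, ∑ b, ∑ d, |T x a b d| ≤ N * (C * S ^ 2) := by
  classical
  obtain ⟨x₀⟩ := ‹Nonempty ι›
  have hS0 : 0 ≤ S := (Finset.sum_nonneg fun v _ => div_nonneg zero_le_one (zero_le_one.trans (hρ1 x₀ v))).trans (hS x₀)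
  have hN0 : 0 ≤ N := (Finset.sum_nonneg fun a _ => Nat.cast_nonneg _).trans (hn x₀)
  have hin : ∀ x a b, ∑ d, |T x a b d| ≤ C / ρ x q * S := fun x a b =>
    (Finset.sum_le_sum fun d _ => hT x a b d).trans (leg_tri_sum_le hC hρ1 hS x q)
  have hxa : ∀ x a, ∑ b, ∑ d, |T x a b d| ≤ ((Finset.univ.filter (fun b => K a b x ≠ 0)).card : ℝ) * (C / ρ x q * S) := fun x a => by
    rw [filter_sum_eq (fun b => K a b x ≠ 0) (fun b => ∑ d, |T x a b d|) (fun b hb =>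
      Finset.sum_eq_zero fun d _ => by rw [h0 x a b (not_not.1 hb) d, abs_zero])]
    exact card_mul_le _ _ fun b _ => hin x a b
  have hx : ∀ x, ∑ a, ∑ b, ∑ d, |T x a b d| ≤ N * (C / ρ x q * S) := fun x => by
    have hc : 0 ≤ C / ρ x q * S := mul_nonneg (div_nonneg hC (zero_le_one.trans (hρ1 x q))) hS0
    calc ∑ a, ∑ b, ∑ d, |T x a b d| ≤ ∑ a, ((Finset.univ.filter (fun b => K a b x ≠ 0)).card : ℝ) * (C / ρ x q * S) :=
          Finset.sum_le_sum fun a _ => hxa x a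
      _ = (∑ a, ((Finset.univ.filter (fun b => K a b x ≠ 0)).card : ℝ)) * (C / ρ x q * S) := by rw [Finset.sum_mul]
      _ ≤ N * (C / ρ x q * S) := mul_le_mul_of_nonneg_right (hn x) hc
  calc ∑ x, ∑ a, ∑ b, ∑ d, |T x a b d| ≤ ∑ x, N * (C / ρ x q * S) := Finset.sum_le_sum fun x _ => hx x
    _ = N * ∑ x, C / ρ x q * S := (Finset.mul_sum _ _ _).symm
    _ ≤ N * (C * S ^ 2) := mul_le_mul_of_nonneg_left (vertex_leg_sum_le hC hρsymm hS hS0 q) hN0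

/-- **PAIR THROUGH THE VERTEX, THE OTHER MEMBER COUNTED** (`𝟙[K b x]·C∕(ρ_{xc}ρ_{xd})`, the pair `(b,x)` counted: `Σ_b #{x} ≤ N`; summed over
`b, x, c, d`): `≤ N·C·S²`. [folklore] -/
theorem pair_vertex_member_fixed (T : ι → ι → ι → ι → ℝ) (K : ι → ι → ℝ) (hC : 0 ≤ C) (hρ1 : ∀ x y, 1 ≤ ρ x y) (hS : ∀ u, ∑ v, 1 / ρ u v ≤ S)
    (h0 : ∀ b x, K b x = 0 → ∀ c d, T b x c d = 0) (hT : ∀ b x c d, |T b x c d| ≤ C / (ρ x c * ρ x d))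
    (hn : ∑ b, ((Finset.univ.filter (fun x => K b x ≠ 0)).card : ℝ) ≤ N) :
    ∑ b, ∑ x, ∑ c, ∑ d, |T b x c d| ≤ N * (C * S ^ 2) := by
  classical
  have hin : ∀ b x, ∑ c, ∑ d, |T b x c d| ≤ C * S ^ 2 := fun b x =>
    (Finset.sum_le_sum fun c _ => Finset.sum_le_sum fun d _ => hT b x c d).trans (tree_double_sum_le hC hρ1 x (hS x))
  have hCS : 0 ≤ C * S ^ 2 := by positivity
  have hb : ∀ b, ∑ x, ∑ c, ∑ d, |T b x c d| ≤ ((Finset.univ.filter (fun x => K b x ≠ 0)).card : ℝ) * (C * S ^ 2) := fun b => by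
    rw [filter_sum_eq (fun x => K b x ≠ 0) (fun x => ∑ c, ∑ d, |T b x c d|) (fun x hx =>
      Finset.sum_eq_zero fun c _ => Finset.sum_eq_zero fun d _ => by rw [h0 b x (not_not.1 hx) c d, abs_zero])]
    exact card_mul_le _ _ fun x _ => hin b x
  calc ∑ b, ∑ x, ∑ c, ∑ d, |T b x c d| ≤ ∑ b, ((Finset.univ.filter (fun x => K b x ≠ 0)).card : ℝ) * (C * S ^ 2) :=
        Finset.sum_le_sum fun b _ => hb b
    _ = (∑ b, ((Finset.univ.filter (fun x => K b x ≠ 0)).card : ℝ)) * (C * S ^ 2) := by rw [Finset.sum_mul]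
    _ ≤ N * (C * S ^ 2) := mul_le_mul_of_nonneg_right hn hCS

/-- **A COUNTED PAIR AGAINST A LEG FUNCTION** (`𝟙[K b c]·C∕(ρ_{xℓ(b,c)}ρ_{xd})`: the pair `(b,c)` counted `Σ_b #{c} ≤ N`, the first leg's site a
function `ℓ` of the pair — the fixed vertex leg `ℓ ≡ a₀` or a pair member `ℓ(c,a) = a`; summed over `b, c, x, d`): `≤ N·C·S²`. [folklore] -/
theorem pair_counted_leg_fn [Nonempty ι] (T : ι → ι → ι → ι → ℝ) (K : ι → ι → ℝ) (ℓ : ι → ι → ι) (hC : 0 ≤ C) (hρ1 : ∀ x y, 1 ≤ ρ x y)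
    (hρsymm : ∀ x y, ρ x y = ρ y x) (hS : ∀ u, ∑ v, 1 / ρ u v ≤ S) (h0 : ∀ b c, K b c = 0 → ∀ x d, T b c x d = 0)
    (hT : ∀ b c x d, |T b c x d| ≤ C / (ρ x (ℓ b c) * ρ x d)) (hn : ∑ b, ((Finset.univ.filter (fun c => K b c ≠ 0)).card : ℝ) ≤ N) :
    ∑ b, ∑ c, ∑ x, ∑ d, |T b c x d| ≤ N * (C * S ^ 2) := by
  classical
  obtain ⟨x₀⟩ := ‹Nonempty ι›
  have hS0 : 0 ≤ S := (Finset.sum_nonneg fun v _ => div_nonneg zero_le_one (zero_le_one.trans (hρ1 x₀ v))).trans (hS x₀)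
  have hin : ∀ b c, ∑ x, ∑ d, |T b c x d| ≤ C * S ^ 2 := fun b c =>
    (Finset.sum_le_sum fun x _ => (Finset.sum_le_sum fun d _ => hT b c x d).trans (leg_tri_sum_le hC hρ1 hS x (ℓ b c))).trans
      (vertex_leg_sum_le hC hρsymm hS hS0 (ℓ b c))
  have hCS : 0 ≤ C * S ^ 2 := by positivity
  have hb : ∀ b, ∑ c, ∑ x, ∑ d, |T b c x d| ≤ ((Finset.univ.filter (fun c => K b c ≠ 0)).card : ℝ) * (C * S ^ 2) := fun b => by
    rw [filter_sum_eq (fun c => K b c ≠ 0) (fun c => ∑ x, ∑ d, |T b c x d|) (fun c hc =>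
      Finset.sum_eq_zero fun x _ => Finset.sum_eq_zero fun d _ => by rw [h0 b c (not_not.1 hc) x d, abs_zero])]
    exact card_mul_le _ _ fun c _ => hin b c
  calc ∑ b, ∑ c, ∑ x, ∑ d, |T b c x d| ≤ ∑ b, ((Finset.univ.filter (fun c => K b c ≠ 0)).card : ℝ) * (C * S ^ 2) :=
        Finset.sum_le_sum fun b _ => hb b
    _ = (∑ b, ((Finset.univ.filter (fun c => K b c ≠ 0)).card : ℝ)) * (C * S ^ 2) := by rw [Finset.sum_mul]
    _ ≤ N * (C * S ^ 2) := mul_le_mul_of_nonneg_right hn hCS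

/-- **PAIR ON A LEG, THE OTHER LEG FIXED** (`𝟙[K b c a]·C∕(ρ_{xa}ρ_{xq})`, `q` fixed, the pair `(b,c)` riding on the summed leg `a`: `Σ_b #{c} ≤ N`
for every `a`; summed over `x, a, b, c`): `≤ N·C·S²`. [folklore] -/
theorem pair_leg_otherleg_fixed [Nonempty ι] (T : ι → ι → ι → ι → ℝ) (K : ι → ι → ι → ℝ) (q : ι) (hC : 0 ≤ C) (hρ1 : ∀ x y, 1 ≤ ρ x y)
    (hρsymm : ∀ x y, ρ x y = ρ y x) (hS : ∀ u, ∑ v, 1 / ρ u v ≤ S) (h0 : ∀ a b c, K b c a = 0 → ∀ x, T x a b c = 0)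
    (hT : ∀ x a b c, |T x a b c| ≤ C / (ρ x q * ρ x a)) (hn : ∀ a, ∑ b, ((Finset.univ.filter (fun c => K b c a ≠ 0)).card : ℝ) ≤ N) :
    ∑ x, ∑ a, ∑ b, ∑ c, |T x a b c| ≤ N * (C * S ^ 2) := by
  classical
  obtain ⟨x₀⟩ := ‹Nonempty ι›
  have hS0 : 0 ≤ S := (Finset.sum_nonneg fun v _ => div_nonneg zero_le_one (zero_le_one.trans (hρ1 x₀ v))).trans (hS x₀)
  have hN0 : 0 ≤ N := (Finset.sum_nonneg fun b _ => Nat.cast_nonneg _).trans (hn x₀)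
  -- fixed `x, a`: count the pairs `(b,c)` on `a`
  have hab : ∀ x a b, ∑ c, |T x a b c| ≤ ((Finset.univ.filter (fun c => K b c a ≠ 0)).card : ℝ) * (C / (ρ x q * ρ x a)) := fun x a b => by
    rw [filter_sum_eq (fun c => K b c a ≠ 0) (fun c => |T x a b c|) (fun c hc => by rw [h0 a b c (not_not.1 hc) x, abs_zero])]
    exact card_mul_le _ _ fun c _ => hT x a b c
  have hxa : ∀ x a, ∑ b, ∑ c, |T x a b c| ≤ N * (C / (ρ x q * ρ x a)) := fun x a => by
    have hc : 0 ≤ C / (ρ x q * ρ x a) := div_nonneg hC (mul_nonneg (zero_le_one.trans (hρ1 x q)) (zero_le_one.trans (hρ1 x a)))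
    calc ∑ b, ∑ c, |T x a b c| ≤ ∑ b, ((Finset.univ.filter (fun c => K b c a ≠ 0)).card : ℝ) * (C / (ρ x q * ρ x a)) :=
          Finset.sum_le_sum fun b _ => hab x a b
      _ = (∑ b, ((Finset.univ.filter (fun c => K b c a ≠ 0)).card : ℝ)) * (C / (ρ x q * ρ x a)) := by rw [Finset.sum_mul]
      _ ≤ N * (C / (ρ x q * ρ x a)) := mul_le_mul_of_nonneg_right (hn a) hc
  have hx : ∀ x, ∑ a, ∑ b, ∑ c, |T x a b c| ≤ N * (C / ρ x q * S) := fun x =>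
    calc ∑ a, ∑ b, ∑ c, |T x a b c| ≤ ∑ a, N * (C / (ρ x q * ρ x a)) := Finset.sum_le_sum fun a _ => hxa x a
      _ = N * ∑ a, C / (ρ x q * ρ x a) := (Finset.mul_sum _ _ _).symm
      _ ≤ N * (C / ρ x q * S) := mul_le_mul_of_nonneg_left (leg_tri_sum_le hC hρ1 hS x q) hN0
  calc ∑ x, ∑ a, ∑ b, ∑ c, |T x a b c| ≤ ∑ x, N * (C / ρ x q * S) := Finset.sum_le_sum fun x _ => hx x
    _ = N * ∑ x, C / ρ x q * S := (Finset.mul_sum _ _ _).symm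
    _ ≤ N * (C * S ^ 2) := mul_le_mul_of_nonneg_left (vertex_leg_sum_le hC hρsymm hS hS0 q) hN0

/-! ## §3. Stars carrying two single riders -/

/-- **THE VERTEX RIDER FIXED** (`𝟙[H₁ x]𝟙[H₂ c b]·C∕(ρ_{xb}ρ_{xd})`, `H₁ x = Hk a₀ x`: `#{x} ≤ N₁`; the leg rider `c` on `b`: `#{c} ≤ N₂` for every
`b`; summed over `x, b, c, d`): `≤ N₁·N₂·C·S²`. [folklore] -/
theorem vertex_rider_fixed [Nonempty ι] (T : ι → ι → ι → ι → ℝ) (H₁ : ι → ℝ) (H₂ : ι → ι → ℝ) (hC : 0 ≤ C) (hρ1 : ∀ x y, 1 ≤ ρ x y)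
    (hS : ∀ u, ∑ v, 1 / ρ u v ≤ S) (h01 : ∀ x, H₁ x = 0 → ∀ b c d, T x b c d = 0) (h02 : ∀ b c, H₂ c b = 0 → ∀ x d, T x b c d = 0)
    (hT : ∀ x b c d, |T x b c d| ≤ C / (ρ x b * ρ x d)) (hn1 : ((Finset.univ.filter (fun x => H₁ x ≠ 0)).card : ℝ) ≤ N₁)
    (hn2 : ∀ b, ((Finset.univ.filter (fun c => H₂ c b ≠ 0)).card : ℝ) ≤ N₂) :
    ∑ x, ∑ b, ∑ c, ∑ d, |T x b c d| ≤ N₁ * N₂ * (C * S ^ 2) := by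
  classical
  obtain ⟨x₀⟩ := ‹Nonempty ι›
  have hS0 : 0 ≤ S := (Finset.sum_nonneg fun v _ => div_nonneg zero_le_one (zero_le_one.trans (hρ1 x₀ v))).trans (hS x₀)
  have hN2 : 0 ≤ N₂ := (Nat.cast_nonneg _).trans (hn2 x₀)
  have hin : ∀ x b c, ∑ d, |T x b c d| ≤ C / ρ x b * S := fun x b c =>
    (Finset.sum_le_sum fun d _ => hT x b c d).trans (leg_tri_sum_le hC hρ1 hS x b)
  have hxb : ∀ x b, ∑ c, ∑ d, |T x b c d| ≤ N₂ * (C / ρ x b * S) := fun x b => by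
    have hc : 0 ≤ C / ρ x b * S := mul_nonneg (div_nonneg hC (zero_le_one.trans (hρ1 x b))) hS0
    rw [filter_sum_eq (fun c => H₂ c b ≠ 0) (fun c => ∑ d, |T x b c d|) (fun c hc' =>
      Finset.sum_eq_zero fun d _ => by rw [h02 b c (not_not.1 hc') x d, abs_zero])]
    exact (card_mul_le _ _ fun c _ => hin x b c).trans (mul_le_mul_of_nonneg_right (hn2 b) hc)
  have hx : ∀ x, ∑ b, ∑ c, ∑ d, |T x b c d| ≤ N₂ * (C * S ^ 2) := fun x =>
    calc ∑ b, ∑ c, ∑ d, |T x b c d| ≤ ∑ b, N₂ * (C / ρ x b * S) := Finset.sum_le_sum fun b _ => hxb x b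
      _ = N₂ * ∑ b, C / ρ x b * S := (Finset.mul_sum _ _ _).symm
      _ = N₂ * (C * S * ∑ b, 1 / ρ x b) := by
          congr 1; rw [Finset.mul_sum]; exact Finset.sum_congr rfl fun b _ => by ring
      _ ≤ N₂ * (C * S * S) := mul_le_mul_of_nonneg_left (mul_le_mul_of_nonneg_left (hS x) (mul_nonneg hC hS0)) hN2
      _ = N₂ * (C * S ^ 2) := by ring
  have hc2 : 0 ≤ N₂ * (C * S ^ 2) := by positivity
  rw [filter_sum_eq (fun x => H₁ x ≠ 0) (fun x => ∑ b, ∑ c, ∑ d, |T x b c d|) (fun x hx' =>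
    Finset.sum_eq_zero fun b _ => Finset.sum_eq_zero fun c _ => Finset.sum_eq_zero fun d _ => by rw [h01 x (not_not.1 hx') b c d, abs_zero])]
  calc _ ≤ ((Finset.univ.filter (fun x => H₁ x ≠ 0)).card : ℝ) * (N₂ * (C * S ^ 2)) := card_mul_le _ _ fun x _ => hx x
    _ ≤ N₁ * (N₂ * (C * S ^ 2)) := mul_le_mul_of_nonneg_right hn1 hc2
    _ = N₁ * N₂ * (C * S ^ 2) := by ring

/-- **THE FREE LEG FIXED** (`𝟙[H₁ a x]𝟙[H₂ c b]·C∕(ρ_{xb}ρ_{xq})`, `q` fixed; `#{a} ≤ N₁` for every `x`, `#{c} ≤ N₂` for every `b`; summed over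
`x, a, b, c`): `≤ N₁·N₂·C·S²`. [folklore] -/
theorem two_riders_leg_fixed [Nonempty ι] (T : ι → ι → ι → ι → ℝ) (H₁ H₂ : ι → ι → ℝ) (q : ι) (hC : 0 ≤ C) (hρ1 : ∀ x y, 1 ≤ ρ x y)
    (hρsymm : ∀ x y, ρ x y = ρ y x) (hS : ∀ u, ∑ v, 1 / ρ u v ≤ S) (h01 : ∀ x a, H₁ a x = 0 → ∀ b c, T x a b c = 0)
    (h02 : ∀ b c, H₂ c b = 0 → ∀ x a, T x a b c = 0) (hT : ∀ x a b c, |T x a b c| ≤ C / (ρ x b * ρ x q))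
    (hn1 : ∀ x, ((Finset.univ.filter (fun a => H₁ a x ≠ 0)).card : ℝ) ≤ N₁) (hn2 : ∀ b, ((Finset.univ.filter (fun c => H₂ c b ≠ 0)).card : ℝ) ≤ N₂) :
    ∑ x, ∑ a, ∑ b, ∑ c, |T x a b c| ≤ N₁ * N₂ * (C * S ^ 2) := by
  classical
  obtain ⟨x₀⟩ := ‹Nonempty ι›
  have hS0 : 0 ≤ S := (Finset.sum_nonneg fun v _ => div_nonneg zero_le_one (zero_le_one.trans (hρ1 x₀ v))).trans (hS x₀)
  have hN1 : 0 ≤ N₁ := (Nat.cast_nonneg _).trans (hn1 x₀)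
  have hN2 : 0 ≤ N₂ := (Nat.cast_nonneg _).trans (hn2 x₀)
  have hxab : ∀ x a b, ∑ c, |T x a b c| ≤ N₂ * (C / (ρ x b * ρ x q)) := fun x a b => by
    have hc : 0 ≤ C / (ρ x b * ρ x q) := div_nonneg hC (mul_nonneg (zero_le_one.trans (hρ1 x b)) (zero_le_one.trans (hρ1 x q)))
    rw [filter_sum_eq (fun c => H₂ c b ≠ 0) (fun c => |T x a b c|) (fun c hc' => by rw [h02 b c (not_not.1 hc') x a, abs_zero])]
    exact (card_mul_le _ _ fun c _ => hT x a b c).trans (mul_le_mul_of_nonneg_right (hn2 b) hc)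
  have hxa : ∀ x a, ∑ b, ∑ c, |T x a b c| ≤ N₂ * (C / ρ x q * S) := fun x a =>
    calc ∑ b, ∑ c, |T x a b c| ≤ ∑ b, N₂ * (C / (ρ x b * ρ x q)) := Finset.sum_le_sum fun b _ => hxab x a b
      _ = N₂ * ∑ b, C / (ρ x q * ρ x b) := by rw [Finset.mul_sum]; exact Finset.sum_congr rfl fun b _ => by rw [mul_comm (ρ x b)]
      _ ≤ N₂ * (C / ρ x q * S) := mul_le_mul_of_nonneg_left (leg_tri_sum_le hC hρ1 hS x q) hN2
  have hx : ∀ x, ∑ a, ∑ b, ∑ c, |T x a b c| ≤ N₁ * (N₂ * (C / ρ x q * S)) := fun x => by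
    have hc : 0 ≤ N₂ * (C / ρ x q * S) := mul_nonneg hN2 (mul_nonneg (div_nonneg hC (zero_le_one.trans (hρ1 x q))) hS0)
    rw [filter_sum_eq (fun a => H₁ a x ≠ 0) (fun a => ∑ b, ∑ c, |T x a b c|) (fun a ha =>
      Finset.sum_eq_zero fun b _ => Finset.sum_eq_zero fun c _ => by rw [h01 x a (not_not.1 ha) b c, abs_zero])]
    exact (card_mul_le _ _ fun a _ => hxa x a).trans (mul_le_mul_of_nonneg_right (hn1 x) hc)
  calc ∑ x, ∑ a, ∑ b, ∑ c, |T x a b c| ≤ ∑ x, N₁ * (N₂ * (C / ρ x q * S)) := Finset.sum_le_sum fun x _ => hx x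
    _ = N₁ * N₂ * ∑ x, C / ρ x q * S := by rw [Finset.mul_sum]; exact Finset.sum_congr rfl fun x _ => by ring
    _ ≤ N₁ * N₂ * (C * S ^ 2) := mul_le_mul_of_nonneg_left (vertex_leg_sum_le hC hρsymm hS hS0 q) (mul_nonneg hN1 hN2)

/-- **A COUNTED SUPPORT, THEN VERTEX RIDERS, AGAINST A LEG FUNCTION** (`s` in a support of size `≤ N₂` — the fixed leg's rider, or the leg under
a fixed rider; for every vertex `x` the riders `a` number `≤ N₁`; decay `C∕(ρ_{xℓ(s)}ρ_{xd})`; summed over `s, x, a, d`): `≤ N₁·N₂·C·S²`.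
[folklore] -/
theorem counted_then_riders_leg_fn [Nonempty ι] (T : ι → ι → ι → ι → ℝ) (H₁ : ι → ι → ℝ) (H₂ : ι → ℝ) (ℓ : ι → ι) (hC : 0 ≤ C)
    (hρ1 : ∀ x y, 1 ≤ ρ x y) (hρsymm : ∀ x y, ρ x y = ρ y x) (hS : ∀ u, ∑ v, 1 / ρ u v ≤ S)
    (h01 : ∀ x a, H₁ a x = 0 → ∀ s d, T s x a d = 0) (h02 : ∀ s, H₂ s = 0 → ∀ x a d, T s x a d = 0)
    (hT : ∀ s x a d, |T s x a d| ≤ C / (ρ x (ℓ s) * ρ x d)) (hn1 : ∀ x, ((Finset.univ.filter (fun a => H₁ a x ≠ 0)).card : ℝ) ≤ N₁)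
    (hn2 : ((Finset.univ.filter (fun s => H₂ s ≠ 0)).card : ℝ) ≤ N₂) :
    ∑ s, ∑ x, ∑ a, ∑ d, |T s x a d| ≤ N₁ * N₂ * (C * S ^ 2) := by
  classical
  obtain ⟨x₀⟩ := ‹Nonempty ι›
  have hS0 : 0 ≤ S := (Finset.sum_nonneg fun v _ => div_nonneg zero_le_one (zero_le_one.trans (hρ1 x₀ v))).trans (hS x₀)
  have hN1 : 0 ≤ N₁ := (Nat.cast_nonneg _).trans (hn1 x₀)
  have hsxa : ∀ s x a, ∑ d, |T s x a d| ≤ C / ρ x (ℓ s) * S := fun s x a =>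
    (Finset.sum_le_sum fun d _ => hT s x a d).trans (leg_tri_sum_le hC hρ1 hS x (ℓ s))
  have hsx : ∀ s x, ∑ a, ∑ d, |T s x a d| ≤ N₁ * (C / ρ x (ℓ s) * S) := fun s x => by
    have hc : 0 ≤ C / ρ x (ℓ s) * S := mul_nonneg (div_nonneg hC (zero_le_one.trans (hρ1 x (ℓ s)))) hS0
    rw [filter_sum_eq (fun a => H₁ a x ≠ 0) (fun a => ∑ d, |T s x a d|) (fun a ha =>
      Finset.sum_eq_zero fun d _ => by rw [h01 x a (not_not.1 ha) s d, abs_zero])]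
    exact (card_mul_le _ _ fun a _ => hsxa s x a).trans (mul_le_mul_of_nonneg_right (hn1 x) hc)
  have hs : ∀ s, ∑ x, ∑ a, ∑ d, |T s x a d| ≤ N₁ * (C * S ^ 2) := fun s =>
    calc ∑ x, ∑ a, ∑ d, |T s x a d| ≤ ∑ x, N₁ * (C / ρ x (ℓ s) * S) := Finset.sum_le_sum fun x _ => hsx s x
      _ = N₁ * ∑ x, C / ρ x (ℓ s) * S := (Finset.mul_sum _ _ _).symm
      _ ≤ N₁ * (C * S ^ 2) := mul_le_mul_of_nonneg_left (vertex_leg_sum_le hC hρsymm hS hS0 (ℓ s)) hN1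
  have hc1 : 0 ≤ N₁ * (C * S ^ 2) := by positivity
  rw [filter_sum_eq (fun s => H₂ s ≠ 0) (fun s => ∑ x, ∑ a, ∑ d, |T s x a d|) (fun s hs' =>
    Finset.sum_eq_zero fun x _ => Finset.sum_eq_zero fun a _ => Finset.sum_eq_zero fun d _ => by rw [h02 s (not_not.1 hs') x a d, abs_zero])]
  calc _ ≤ ((Finset.univ.filter (fun s => H₂ s ≠ 0)).card : ℝ) * (N₁ * (C * S ^ 2)) := card_mul_le _ _ fun s _ => hs s
    _ ≤ N₂ * (N₁ * (C * S ^ 2)) := mul_le_mul_of_nonneg_right hn2 hc1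
    _ = N₁ * N₂ * (C * S ^ 2) := by ring

/-- **A COUNTED SUPPORT AGAINST A LEG FUNCTION, THE OTHER LEG WITH A RIDER** (`s` in a support of size `≤ N₁`; decay `C∕(ρ_{xℓ(s)}ρ_{xc})` with a
rider `d` on the free leg `c` (`#{d} ≤ N₂` for every `c`); summed over `s, x, c, d`): `≤ N₁·N₂·C·S²`. [folklore] -/
theorem leg_rider_leg_fn [Nonempty ι] (T : ι → ι → ι → ι → ℝ) (H₁ : ι → ℝ) (H₂ : ι → ι → ℝ) (ℓ : ι → ι) (hC : 0 ≤ C) (hρ1 : ∀ x y, 1 ≤ ρ x y)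
    (hρsymm : ∀ x y, ρ x y = ρ y x) (hS : ∀ u, ∑ v, 1 / ρ u v ≤ S) (h01 : ∀ s, H₁ s = 0 → ∀ x c d, T s x c d = 0)
    (h02 : ∀ c d, H₂ d c = 0 → ∀ s x, T s x c d = 0) (hT : ∀ s x c d, |T s x c d| ≤ C / (ρ x (ℓ s) * ρ x c))
    (hn1 : ((Finset.univ.filter (fun s => H₁ s ≠ 0)).card : ℝ) ≤ N₁) (hn2 : ∀ c, ((Finset.univ.filter (fun d => H₂ d c ≠ 0)).card : ℝ) ≤ N₂) :
    ∑ s, ∑ x, ∑ c, ∑ d, |T s x c d| ≤ N₁ * N₂ * (C * S ^ 2) := by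
  classical
  obtain ⟨x₀⟩ := ‹Nonempty ι›
  have hS0 : 0 ≤ S := (Finset.sum_nonneg fun v _ => div_nonneg zero_le_one (zero_le_one.trans (hρ1 x₀ v))).trans (hS x₀)
  have hN2 : 0 ≤ N₂ := (Nat.cast_nonneg _).trans (hn2 x₀)
  have hsxc : ∀ s x c, ∑ d, |T s x c d| ≤ N₂ * (C / (ρ x (ℓ s) * ρ x c)) := fun s x c => by
    have hc : 0 ≤ C / (ρ x (ℓ s) * ρ x c) := div_nonneg hC (mul_nonneg (zero_le_one.trans (hρ1 x (ℓ s))) (zero_le_one.trans (hρ1 x c)))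
    rw [filter_sum_eq (fun d => H₂ d c ≠ 0) (fun d => |T s x c d|) (fun d hd => by rw [h02 c d (not_not.1 hd) s x, abs_zero])]
    exact (card_mul_le _ _ fun d _ => hT s x c d).trans (mul_le_mul_of_nonneg_right (hn2 c) hc)
  have hsx : ∀ s x, ∑ c, ∑ d, |T s x c d| ≤ N₂ * (C / ρ x (ℓ s) * S) := fun s x =>
    calc ∑ c, ∑ d, |T s x c d| ≤ ∑ c, N₂ * (C / (ρ x (ℓ s) * ρ x c)) := Finset.sum_le_sum fun c _ => hsxc s x c
      _ = N₂ * ∑ c, C / (ρ x (ℓ s) * ρ x c) := (Finset.mul_sum _ _ _).symm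
      _ ≤ N₂ * (C / ρ x (ℓ s) * S) := mul_le_mul_of_nonneg_left (leg_tri_sum_le hC hρ1 hS x (ℓ s)) hN2
  have hs : ∀ s, ∑ x, ∑ c, ∑ d, |T s x c d| ≤ N₂ * (C * S ^ 2) := fun s =>
    calc ∑ x, ∑ c, ∑ d, |T s x c d| ≤ ∑ x, N₂ * (C / ρ x (ℓ s) * S) := Finset.sum_le_sum fun x _ => hsx s x
      _ = N₂ * ∑ x, C / ρ x (ℓ s) * S := (Finset.mul_sum _ _ _).symm
      _ ≤ N₂ * (C * S ^ 2) := mul_le_mul_of_nonneg_left (vertex_leg_sum_le hC hρsymm hS hS0 (ℓ s)) hN2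
  have hc2 : 0 ≤ N₂ * (C * S ^ 2) := by positivity
  rw [filter_sum_eq (fun s => H₁ s ≠ 0) (fun s => ∑ x, ∑ c, ∑ d, |T s x c d|) (fun s hs' =>
    Finset.sum_eq_zero fun x _ => Finset.sum_eq_zero fun c _ => Finset.sum_eq_zero fun d _ => by rw [h01 s (not_not.1 hs') x c d, abs_zero])]
  calc _ ≤ ((Finset.univ.filter (fun s => H₁ s ≠ 0)).card : ℝ) * (N₂ * (C * S ^ 2)) := card_mul_le _ _ fun s _ => hs s
    _ ≤ N₁ * (N₂ * (C * S ^ 2)) := mul_le_mul_of_nonneg_right hn1 hc2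
    _ = N₁ * N₂ * (C * S ^ 2) := by ring

/-! ## §4. Supported trees against an abstract weight -/

/-- **THE RIDER FIXED** (`𝟙[H x]·C·W(x;b,c,d)`, `#{x : H x ≠ 0} ≤ N`, `Σ_{b,c,d}W ≤ B` for every `x`): `Σ_{x,b,c,d}|T| ≤ N·C·B`. [folklore] -/
theorem tree_rider_fixed (T W : ι → ι → ι → ι → ℝ) (H : ι → ℝ) (hC : 0 ≤ C) (hB : 0 ≤ B) (h0 : ∀ x, H x = 0 → ∀ b c d, T x b c d = 0)
    (hT : ∀ x b c d, |T x b c d| ≤ C * W x b c d) (hW : ∀ x, ∑ b, ∑ c, ∑ d, W x b c d ≤ B)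
    (hn : ((Finset.univ.filter (fun x => H x ≠ 0)).card : ℝ) ≤ N) :
    ∑ x, ∑ b, ∑ c, ∑ d, |T x b c d| ≤ N * (C * B) := by
  classical
  have hx : ∀ x, ∑ b, ∑ c, ∑ d, |T x b c d| ≤ C * B := fun x => by
    refine (Finset.sum_le_sum fun b _ => Finset.sum_le_sum fun c _ => Finset.sum_le_sum fun d _ => hT x b c d).trans ?_
    simp_rw [← Finset.mul_sum]
    exact mul_le_mul_of_nonneg_left (hW x) hC
  have hCB : 0 ≤ C * B := mul_nonneg hC hB
  rw [filter_sum_eq (fun x => H x ≠ 0) (fun x => ∑ b, ∑ c, ∑ d, |T x b c d|) (fun x hx' =>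
    Finset.sum_eq_zero fun b _ => Finset.sum_eq_zero fun c _ => Finset.sum_eq_zero fun d _ => by rw [h0 x (not_not.1 hx') b c d, abs_zero])]
  exact (card_mul_le _ _ fun x _ => hx x).trans (mul_le_mul_of_nonneg_right hn hCB)

/-- **A LEAF FIXED, RIDERS ON THE VERTEX** (`𝟙[H a x]·C·W(x;c,d)`, `#{a} ≤ N` for every `x`, `Σ_{x,c,d}W ≤ B`): `Σ_{x,a,c,d}|T| ≤ N·C·B`.
[folklore] -/
theorem tree_leaf_fixed_vertex_riders [Nonempty ι] (T : ι → ι → ι → ι → ℝ) (W : ι → ι → ι → ℝ) (H : ι → ι → ℝ) (hC : 0 ≤ C)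
    (hW0 : ∀ x c d, 0 ≤ W x c d) (h0 : ∀ x a, H a x = 0 → ∀ c d, T x a c d = 0) (hT : ∀ x a c d, |T x a c d| ≤ C * W x c d)
    (hW : ∑ x, ∑ c, ∑ d, W x c d ≤ B) (hn : ∀ x, ((Finset.univ.filter (fun a => H a x ≠ 0)).card : ℝ) ≤ N) :
    ∑ x, ∑ a, ∑ c, ∑ d, |T x a c d| ≤ N * (C * B) := by
  classical
  obtain ⟨x₀⟩ := ‹Nonempty ι›
  have hN : 0 ≤ N := (Nat.cast_nonneg _).trans (hn x₀)
  have hx : ∀ x, ∑ a, ∑ c, ∑ d, |T x a c d| ≤ N * (C * ∑ c, ∑ d, W x c d) := fun x => by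
    have hin : ∀ a, ∑ c, ∑ d, |T x a c d| ≤ C * ∑ c, ∑ d, W x c d := fun a => by
      refine (Finset.sum_le_sum fun c _ => Finset.sum_le_sum fun d _ => hT x a c d).trans ?_
      simp_rw [← Finset.mul_sum]; exact le_rfl
    have hc : 0 ≤ C * ∑ c, ∑ d, W x c d := mul_nonneg hC (Finset.sum_nonneg fun c _ => Finset.sum_nonneg fun d _ => hW0 x c d)
    rw [filter_sum_eq (fun a => H a x ≠ 0) (fun a => ∑ c, ∑ d, |T x a c d|) (fun a ha =>
      Finset.sum_eq_zero fun c _ => Finset.sum_eq_zero fun d _ => by rw [h0 x a (not_not.1 ha) c d, abs_zero])]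
    exact (card_mul_le _ _ fun a _ => hin a).trans (mul_le_mul_of_nonneg_right (hn x) hc)
  calc ∑ x, ∑ a, ∑ c, ∑ d, |T x a c d| ≤ ∑ x, N * (C * ∑ c, ∑ d, W x c d) := Finset.sum_le_sum fun x _ => hx x
    _ = N * (C * ∑ x, ∑ c, ∑ d, W x c d) := by rw [Finset.mul_sum, Finset.mul_sum]
    _ ≤ N * (C * B) := mul_le_mul_of_nonneg_left (mul_le_mul_of_nonneg_left hW hC) hN

/-- **A COUNTED INDEX AGAINST A SUMMED WEIGHT** (`s` in a support of size `≤ N`; `|T s x c d| ≤ C·W(s;x,c,d)` with `Σ_{x,c,d}W(s;·) ≤ B` for every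
`s` — a fixed leaf's rider, or the leaf under a fixed rider): `Σ_{s,x,c,d}|T| ≤ N·C·B`. [folklore] -/
theorem tree_counted_weight (T W : ι → ι → ι → ι → ℝ) (H : ι → ℝ) (hC : 0 ≤ C) (hB : 0 ≤ B) (h0 : ∀ s, H s = 0 → ∀ x c d, T s x c d = 0)
    (hT : ∀ s x c d, |T s x c d| ≤ C * W s x c d) (hW : ∀ s, ∑ x, ∑ c, ∑ d, W s x c d ≤ B)
    (hn : ((Finset.univ.filter (fun s => H s ≠ 0)).card : ℝ) ≤ N) :
    ∑ s, ∑ x, ∑ c, ∑ d, |T s x c d| ≤ N * (C * B) :=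
  tree_rider_fixed T W H hC hB h0 hT hW hn

/-- **A LEAF FIXED, A RIDER ON ANOTHER LEAF** (`𝟙[H b a]·C·W(x;a,d)`, `#{b} ≤ N` for every leaf `a`, `Σ_{x,a,d}W ≤ B`): `Σ_{x,a,b,d}|T| ≤ N·C·B`.
[folklore] -/
theorem tree_leaf_fixed_leaf_rider [Nonempty ι] (T : ι → ι → ι → ι → ℝ) (W : ι → ι → ι → ℝ) (H : ι → ι → ℝ) (hC : 0 ≤ C)
    (hW0 : ∀ x a d, 0 ≤ W x a d) (h0 : ∀ a b, H b a = 0 → ∀ x d, T x a b d = 0) (hT : ∀ x a b d, |T x a b d| ≤ C * W x a d)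
    (hW : ∑ x, ∑ a, ∑ d, W x a d ≤ B) (hn : ∀ a, ((Finset.univ.filter (fun b => H b a ≠ 0)).card : ℝ) ≤ N) :
    ∑ x, ∑ a, ∑ b, ∑ d, |T x a b d| ≤ N * (C * B) := by
  classical
  obtain ⟨x₀⟩ := ‹Nonempty ι›
  have hN : 0 ≤ N := (Nat.cast_nonneg _).trans (hn x₀)
  have hxa : ∀ x a, ∑ b, ∑ d, |T x a b d| ≤ N * (C * ∑ d, W x a d) := fun x a => by
    have hin : ∀ b, ∑ d, |T x a b d| ≤ C * ∑ d, W x a d := fun b => by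
      rw [Finset.mul_sum]; exact Finset.sum_le_sum fun d _ => hT x a b d
    have hc : 0 ≤ C * ∑ d, W x a d := mul_nonneg hC (Finset.sum_nonneg fun d _ => hW0 x a d)
    rw [filter_sum_eq (fun b => H b a ≠ 0) (fun b => ∑ d, |T x a b d|) (fun b hb =>
      Finset.sum_eq_zero fun d _ => by rw [h0 a b (not_not.1 hb) x d, abs_zero])]
    exact (card_mul_le _ _ fun b _ => hin b).trans (mul_le_mul_of_nonneg_right (hn a) hc)
  calc ∑ x, ∑ a, ∑ b, ∑ d, |T x a b d| ≤ ∑ x, ∑ a, N * (C * ∑ d, W x a d) :=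
        Finset.sum_le_sum fun x _ => Finset.sum_le_sum fun a _ => hxa x a
    _ = N * (C * ∑ x, ∑ a, ∑ d, W x a d) := by simp_rw [Finset.mul_sum]
    _ ≤ N * (C * B) := mul_le_mul_of_nonneg_left (mul_le_mul_of_nonneg_left hW hC) hN

/-! ## §5. Toy -/

/-- Toy (§1 in numbers): a symmetric weight's column sums equal its row sums. -/
example (w : Fin 2 → Fin 2 → ℝ) (h : ∀ i j, w i j = w j i) (j : Fin 2) : ∑ i, w i j = ∑ i, w j i :=
  Finset.sum_congr rfl fun i _ => h i j

end Summit.QuantumFields.BalabanUV.T4Continuum.NE7b.SupFifthKernelSlotSupportSums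

end
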